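import Mathlib
import HarnessLib
import Literature.Analysis.Convex.DouglasRachfordSplitting
import Literature.Analysis.Convex.SplittingConicSolver

/-!
# Douglas–Rachford splitting for monotone (linear) complementarity problems over a cone,
# and SCS as a Douglas–Rachford iteration

Literature anchor (statements and proofs follow the sources; nothing here is new mathematics):

* [ODo21] B. O'Donoghue, *Operator splitting for a homogeneous embedding of the linear
  complementarity problem*, SIAM J. Optim. 31 (2021) 1999–2023, arXiv:2004.02177 (held: `lit` key
  `paper-arxiv-2004.02177`; bib: Odonoghue2021):
  **§2.2** ("the resolvent of a maximal monotone operator is always single-valued … and has full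
  domain"), **§3** (the monotone complementarity problem MCP(F, 𝒞): `∃ w ∈ F(z)` with
  `𝒞 ∋ z ⊥ w ∈ 𝒞*` (3.1); its equivalence with the variational inequality `(y − z)ᵀw ≥ 0 ∀ y ∈ 𝒞`
  (3.2) — "take `y = z/2` or `y = 3z/2`" — and with the inclusion `0 ∈ F(z) + N_𝒞(z)` (3.3);
  "`N_𝒞` is maximal monotone with resolvent `(I + N_𝒞)⁻¹ x = Π_𝒞(x)`"; an affine `F(z) = Mz + q`
  is monotone iff `M` is (3.4), giving LCP(M, q, 𝒞) (3.5); the fact `zᵀMz = 0 ⟺ (M + Mᵀ)z = 0`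
  (3.6)), **§4.2** ("LCP(M, q, 𝒞) is feasible if and only if there exists a point
  `(z, w) ∈ N_𝒞 ∩ 𝒜`", `𝒜 = {(z, −(Mz + q))}`; the strong-infeasibility conditions (4.4)
  `λᵀq < 0`, `sup_{(z,w) ∈ N_𝒞} λᵀ(Mz + w) ≤ 0`; **Lemma 2**: `λ` satisfies (4.4) iff it solves
  LCP(M, 0, 𝒞) with `λᵀq < 0`; "at most one of (4.4) and (3.5) has a solution … weak
  alternatives"), **§5, (5.2)** (Douglas–Rachford splitting applied to LCP(M, q, 𝒞) directly:
  `ũ^{k+1} = (I + M)⁻¹(w^k − q)`, `u^{k+1} = Π_𝒞(2ũ^{k+1} − w^k)`,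
  `w^{k+1} = w^k + u^{k+1} − ũ^{k+1}`; "if a solution to LCP(M, q, 𝒞) exists then this procedure
  will converge", with the guarantees recalled in §2.1: `‖u^k − ũ^k‖ → 0`, `u^k → u⋆`,
  `w^k → w⋆ ∈ u⋆ + F(u⋆)`), **§5.3, Lemma 5** (a positively homogeneous map that is nonexpansive
  toward its fixed points, with a fixed point `w⋆`, `(w⋆)ᵀw⁰ > 0`, has
  `‖w^k‖ ≥ (w⋆)ᵀw⁰/‖w⋆‖ > 0` for all `k` — "here we generalize a result from [OCPB16]"),
  **§5.4** (`v^{k+1} = u^{k+1} + w^k − 2ũ^{k+1} = Π_{𝒞*}(−2ũ^{k+1} + w^k)`, so that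
  `𝒞 ∋ u^k ⊥ v^k ∈ 𝒞*` for all `k` (5.6) and `v^{k+1} → w⋆ − u⋆ ∈ F(u⋆)`), and the last
  paragraph of **§5.2** ("we recover SCS … modulo the change of variables required to go from
  ADMM to DR splitting").
* [OCPB16] B. O'Donoghue, E. Chu, N. Parikh, S. Boyd, *Conic optimization via operator splitting
  and homogeneous self-dual embedding*, J. Optim. Theory Appl. 169 (2016) 1042–1068,
  arXiv:1312.3039 (held: `paper-arxiv-1312.3039`; bib: OdonoghueEtAl2016): **§3.2.3** ("the
  second and third steps [are] a combined Moreau decomposition"), **Appendix** (`φ = P ∘ L` with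
  `P(x) = (Π_C(x), −Π_{−C*}(x))`, `L(u, v) = (I + Q)⁻¹(u + v) − v`) and **§3.4, (17)** ("only one
  more condition must hold for `(u^k, v^k)` to be optimal: `Qu^k = v^k`. This equality constraint
  holds asymptotically … `Qu^k − v^k → 0`", which [OCPB16] imports "from general ADMM
  convergence theory; see, e.g., [BP:11], or [EB:92]").
* [EB92] J. Eckstein, D. P. Bertsekas, *On the Douglas–Rachford splitting method and the proximal
  point algorithm for maximal monotone operators*, Math. Programming 55 (1992) 293–318 (bib:
  EcksteinBertsekas1992): **§4, Cor 6.1** — the convergence theorem actually invoked below, through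
  `Literature.Analysis.Convex.DouglasRachford.exists_tendsto_drIter`.

Section, lemma and equation numbers of [ODo21] are those of arXiv:2004.02177 = the SIAM
J. Optim. layout (equations numbered within sections: (3.1) = MCP, (3.2) = the variational
inequality, (3.3) = the inclusion, (3.4) = `M + Mᵀ ⪰ 0`, (3.5) = LCP, (3.6) = the fact
`zᵀMz = 0 ⟺ (M + Mᵀ)z = 0`, (4.4) = the strong-infeasibility conditions, (4.5) = LCP(M, 0, 𝒞)
in Lemma 2, (5.1) = DR for the embedding, (5.2) = DR for the LCP directly, (5.6) =
`𝒞₊ ∋ u^k ⊥ v^k ∈ 𝒞₊*`); every equation cited is also identified in words in the docstrings.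
Everything is proved; there are no named facts and no `sorry`.

## What is formalised, and the setting

[ODo21] works in `ℝ^d` with a matrix `M` and a nonempty closed convex cone `𝒞`. Here `E` is a real
Hilbert space (a `ProperSpace`, i.e. finite dimension, for the two convergence statements),
`K : ProperCone ℝ E` (Mathlib: nonempty closed convex cone) plays `𝒞`, with dual cone
`𝒞* = ProperCone.innerDual K` and cone projection `Π_𝒞 = MoreauDecomposition.proj K` (Moreau:
`x = Π_K x + Π_{K°} x`, `K° = −K*`, file `MoreauConeDecomposition`); an operator `F` is a subset of
`E × E` and `N_𝒞 = DouglasRachford.normalCone ↑K`, `zer`, `opSum`, `graph`, resolvent maps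
`IsResolventMap` are those of `MonotoneOperatorResolvent` / `DouglasRachfordSplitting`; `M`, `Q`,
`R` are linear maps `E →ₗ[ℝ] E`, "`M` monotone" is `∀ z, 0 ≤ ⟪z, M z⟫`, `R = (I + M)⁻¹` is
`SplittingConicSolver.IsResolvent M R` (`R z + M (R z) = z`), and the SCS objects `IsSkew`,
`linStep`, `scsStep`, `scsIter` are those of `SplittingConicSolver`.

* §3: `IsMCPSolution F K z` (3.1), `IsVISolution F K z` (3.2) and their equivalence
  (`mem_innerDual_and_inner_eq_zero_iff`, `isMCPSolution_iff_isVISolution`); the normal cone of a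
  cone, `x ∈ N_𝒞(z) ⟺ z ∈ 𝒞, −x ∈ 𝒞*, zᵀx = 0` (`mem_normalCone_iff_mem_innerDual`, the step
  "`−w ∈ 𝒞*`" of the proof of Lemma 2); (3.1) ⟺ (3.3) (`isMCPSolution_iff_mem_zer`,
  `isMCPSolution_iff_mem_zer'`); `Π_𝒞` is the resolvent map of `N_𝒞` (`isResolventMap_coneProj`);
  LCP(M, q, 𝒞) (`IsLCPSolution`, `isLCPSolution_iff_isMCPSolution`), (3.4)
  (`isMonotone_graph_iff`, `isMonotone_graph_affine_iff`) and (3.6) in adjoint-free form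
  (`inner_add_inner_eq_zero`: `zᵀMz = 0 ⟹ yᵀMz + zᵀMy = 0` for all `y`).
* §2.2 for linear monotone `M`: `I + M` is injective (`add_monotone_injective`) and, in finite
  dimension, invertible, giving a LINEAR resolvent `R = (I + M)⁻¹` (`exists_isResolvent`; for a
  general maximal monotone operator this is Minty's theorem,
  `MonotoneOperator.IsMaximalMonotone.exists_isResolventMap` of the anchor `MintyTheorem`, not
  used here); the resolvent maps of `graph Q` and of the affine operator `z ↦ Mz + q`
  (`isResolventMap_of_isResolvent`, `isResolventMap_lcpTilde`).
* §4.2: feasibility as `(z, −(Mz + q)) ∈ N_𝒞` (`isLCPSolution_iff_mem_normalCone`); the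
  certificate (4.4) (`IsInfeasCert`); **Lemma 2** (`isInfeasCert_iff`); weak alternatives
  (`not_isLCPSolution_of_isInfeasCert`).
* §5, (5.2): `lcpTilde R q w = R (w − q)` (`ũ`), `lcpU` (`u`), `lcpStep` (`w ↦ w⁺`), `lcpIter`
  (`w^k`); the identification with the Douglas–Rachford step of `DouglasRachfordSplitting` for the
  pair `(N_𝒞, F)` (`lcpStep_eq_drStep`, `lcpIter_eq_drIter`); `w = ũ + F(ũ)` (`lcpTilde_spec`);
  nonexpansiveness (`norm_lcpStep_sub_le`); fixed points give solutions and conversely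
  (`isLCPSolution_of_lcpStep_eq_self`, `exists_lcpStep_eq_self`); **convergence** when a solution
  exists, in finite dimension (`exists_tendsto_lcpIter`: `w^k → w⋆` a fixed point), and from
  `w^k → w⋆` the limits `ũ^k → ũ⋆ = (I + M)⁻¹(w⋆ − q)` (a solution), `u^k → ũ⋆`, `u^k − ũ^k → 0`
  (`tendsto_lcpTilde`, `tendsto_lcpU`, `tendsto_lcpU_sub_lcpTilde`).
* §5.4: `lcpV` (`v^{k+1} = u^{k+1} + w^k − 2ũ^{k+1}`), `lcpV_eq_proj_innerDual`
  (`= Π_{𝒞*}(w^k − 2ũ^{k+1})`), (5.6) (`lcpU_mem`, `lcpV_mem_innerDual`, `inner_lcpU_lcpV`) and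
  `v^{k+1} → Mũ⋆ + q = F(u⋆)` (`tendsto_lcpV`).
* §5.3, **Lemma 5** verbatim for a self-map of a real inner product space
  (`norm_iterate_ge_of_homogeneous`), and its instances for the homogeneous problem LCP(M, 0, 𝒞)
  (`lcpStep_zero_smul`, `norm_lcpIter_zero_ge`) and for SCS (`norm_scsIter_ge'`, which sharpens
  the constant `⟨p, z⁰⟩/(2‖p‖)` of [OCPB16, §3.4] / `SplittingConicSolver.norm_scsIter_ge` to
  Lemma 5's `⟨p, z⁰⟩/‖p‖`).
* SCS = Douglas–Rachford ([OCPB16, §3.2.3, Appendix]; [ODo21, §5.2]): with the Moreau pair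
  `moreauPair K x = (Π_K x, Π_K x − x)` (the map `P`) one has `φ = P ∘ L`
  (`scsStep_eq_moreauPair_linStep`) and `L ∘ P = ` the Douglas–Rachford step for the pair
  `(graph Q, N_K)` with resolvent maps `(R, Π_K)` (`linStep_moreauPair`), hence
  `φ(P x) = P(DR x)` (`scsStep_moreauPair`), `φ^k(P x) = P(DR^k x)` (`scsIter_moreauPair`) and
  `φ^{k+1}(u⁰, v⁰) = P(DR^k(L(u⁰, v⁰)))` (`scsIter_succ_eq_moreauPair_drIter`).  Consequently
  (finite dimension; `0` is always a zero of `graph Q + N_K`) **the SCS iterates converge to a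
  fixed point of `φ`** (`exists_tendsto_scsIter`), [OCPB16, (17)] `Qu^k − v^k → 0`
  (`tendsto_skew_fst_sub_snd`), and the limit is bounded below by Lemma 5
  (`div_le_norm_of_tendsto_scsIter`, so it is a NONZERO solution of the embedding whenever some
  solution `p̂` has `⟨p̂, (u⁰, v⁰)⟩ > 0`, `ne_zero_of_tendsto_scsIter`).

Deviations.  (i) [ODo21]'s main object — the homogeneous embedding MCP(𝒬, 𝒞₊) of §4 with
`𝒬 = ℱ ∪ ℐ`, its maximality (Lemma 4), the resolvent of `𝒬` via `root₊` (§5.1) and Algorithm 1 —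
is NOT formalised (Lemma 4 rests on a maximal monotone extension "with domain contained in the
closure of the convex hull of its domain [bauschke2011convex]"; the library has the extension,
`MonotoneOperator.IsMonotone.exists_isMaximalMonotone_superset` of the anchor `MintyTheorem`,
but not the domain control); only the direct iteration (5.2) — "the procedure in Equation (5.2)
can be interpreted as Algorithm 1 where we fix the scalar parameters `τ = τ̃ = η = 1`" (§5.2) —
and the abstract Lemma 5 are.  (ii) In Lemma 2 the equivalence "strongly infeasible
(dist(N_𝒞, 𝒜) > 0) ⟺ (4.4)" rests on a strong-separation theorem [rockafellar1970convex] and is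
not formalised: (4.4) is taken as the definition of a certificate (`IsInfeasCert`), and Lemma 2 is
the proved equivalence (4.4) ⟺ (4.5) ∧ `λᵀq < 0`.  (iii) (3.6) is stated without adjoints as
`yᵀMz + zᵀMy = 0`.  (iv) Convergence is strong convergence in finite dimension (the setting of
both papers); rates (`o(1/k)`, §2.1), approximate resolvents, over-relaxation and the QCP
dictionary of §3.1/§4.2.1/§5.4 (`u = (x, y, τ)`) are not formalised.  (v) [OCPB16, (17)] is
obtained here from the convergence of the whole sequence `(u^k, v^k)` (Douglas–Rachford,
[EB92, Cor 6.1]) rather than from the ADMM argument sketched in [OCPB16, §3.4].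
-/

noncomputable section

open Filter Topology
open scoped RealInnerProductSpace
open Literature.Analysis.Convex.MonotoneOperator
open Literature.Analysis.Convex.DouglasRachford
open Literature.Analysis.Convex.MoreauDecomposition
open Literature.Analysis.Convex.SplittingConicSolver

namespace Literature.Analysis.Convex.DouglasRachfordLCP

variable {E : Type*} [NormedAddCommGroup E] [InnerProductSpace ℝ E]
variable {M Q R : E →ₗ[ℝ] E} {q x z w lam : E}

/-! ## §2.2–§3: linear monotone operators (no completeness needed) -/

/-- **(3.4)** for a linear map: the operator `graph M` is monotone iff `zᵀMz ≥ 0` for all `z`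
("`M + Mᵀ ⪰ 0`"). [cite: Odonoghue2021, §3 (3.4)] -/
theorem isMonotone_graph_iff : IsMonotone (graph M) ↔ ∀ z, 0 ≤ ⟪z, M z⟫ := by
  constructor
  · intro h z
    have := h (mem_graph_iff.2 (map_zero M).symm) (mem_graph_iff.2 rfl : (z, M z) ∈ graph M)
    rwa [sub_zero, sub_zero] at this
  · intro h x y hxy x' y' hx'y'
    rw [mem_graph_iff] at hxy hx'y'
    rw [hxy, hx'y', ← map_sub]
    exact h _

/-- **(3.4)**: "an affine function `F(z) = Mz + q` … is maximal monotone if and only if `M` is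
monotone". [cite: Odonoghue2021, §3 (3.4)] -/
theorem isMonotone_graph_affine_iff (q : E) :
    IsMonotone (graph fun z => M z + q) ↔ ∀ z, 0 ≤ ⟪z, M z⟫ := by
  constructor
  · intro h z
    have := h (mem_graph_iff.2 rfl : ((0 : E), M 0 + q) ∈ graph fun z => M z + q)
      (mem_graph_iff.2 rfl : (z, M z + q) ∈ graph fun z => M z + q)
    rwa [sub_zero, map_zero, zero_add, add_sub_cancel_right] at this
  · intro h x y hxy x' y' hx'y'
    rw [mem_graph_iff] at hxy hx'y'
    rw [hxy, hx'y', add_sub_add_right_eq_sub, ← map_sub]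
    exact h _

/-- A skew `Q` (`⟨Qx, x⟩ = 0`, the embedding matrix of [OCPB16]) is monotone.
[cite: Odonoghue2021, §3 (3.4); OdonoghueEtAl2016, §3.4] -/
theorem isMonotone_graph_of_isSkew (hQ : IsSkew Q) : IsMonotone (graph Q) :=
  isMonotone_graph_iff.2 fun z => (inner_skew_apply_self hQ z).ge

/-- **(3.6)** "`zᵀMz = 0 ⟺ (M + Mᵀ)z = 0`" for monotone `M`, in adjoint-free form: if `zᵀMz = 0`
then `yᵀMz + zᵀMy = 0` for every `y` (the nonnegative quadratic `t ↦ (z + ty)ᵀM(z + ty)` vanishes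
at `t = 0`, so its linear coefficient vanishes). [cite: Odonoghue2021, §3 (3.6)] -/
theorem inner_add_inner_eq_zero (hM : ∀ z, 0 ≤ ⟪z, M z⟫) (h : ⟪z, M z⟫ = 0) (y : E) :
    ⟪y, M z⟫ + ⟪z, M y⟫ = 0 := by
  set b := ⟪y, M z⟫ + ⟪z, M y⟫ with hb
  set c := ⟪y, M y⟫ with hc
  have hc0 : 0 ≤ c := hM y
  have key : ∀ t : ℝ, 0 ≤ t * b + t ^ 2 * c := by
    intro t
    have e : ⟪z + t • y, M (z + t • y)⟫ = t * b + t ^ 2 * c := by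
      simp only [map_add, map_smul, inner_add_left, inner_add_right, real_inner_smul_left,
        real_inner_smul_right, h, hb, hc]
      ring
    rw [← e]
    exact hM _
  have h1 := key (-b / (c + 1))
  have e2 : -b / (c + 1) * b + (-b / (c + 1)) ^ 2 * c = -(b ^ 2) / (c + 1) ^ 2 := by
    field_simp
    ring
  rw [e2, le_div_iff₀ (by positivity), zero_mul] at h1
  have h2 : b ^ 2 = 0 := le_antisymm (by linarith) (sq_nonneg b)
  exact (pow_eq_zero_iff two_ne_zero).1 h2

/-- For monotone `M` the map `I + M` is injective (`‖x‖² ≤ xᵀ(x + Mx)`), so the resolvent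
`(I + M)⁻¹` is single-valued. [cite: Odonoghue2021, §2.2] -/
theorem add_monotone_injective (hM : ∀ z, 0 ≤ ⟪z, M z⟫) :
    Function.Injective fun x => x + M x := by
  intro x y hxy
  have h : (x - y) + M (x - y) = 0 := by
    have e : x + M x = y + M y := hxy
    rw [map_sub]
    calc x - y + (M x - M y) = (x + M x) - (y + M y) := by abel
      _ = 0 := by rw [e, sub_self]
  have h2 : ‖x - y‖ ^ 2 ≤ 0 := by
    have e : ⟪x - y, (x - y) + M (x - y)⟫ = ‖x - y‖ ^ 2 + ⟪x - y, M (x - y)⟫ := by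
      rw [inner_add_right, real_inner_self_eq_norm_sq]
    rw [h, inner_zero_right] at e
    linarith [hM (x - y)]
  have h3 : ‖x - y‖ ^ 2 = 0 := le_antisymm h2 (sq_nonneg _)
  exact sub_eq_zero.1 (norm_eq_zero.1 ((pow_eq_zero_iff two_ne_zero).1 h3))

/-- "The resolvent … is always single-valued … and has full domain": in finite dimension a
monotone `M` has a (linear) resolvent `R = (I + M)⁻¹`, `R z + M(R z) = z` and `R(z + Mz) = z`.
[cite: Odonoghue2021, §2.2] -/
theorem exists_isResolvent [FiniteDimensional ℝ E] (hM : ∀ z, 0 ≤ ⟪z, M z⟫) :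
    ∃ R : E →ₗ[ℝ] E, IsResolvent M R ∧ ∀ z, R (z + M z) = z := by
  have hinj : Function.Injective (LinearMap.id + M : E →ₗ[ℝ] E) := add_monotone_injective hM
  have hbij : Function.Bijective (LinearMap.id + M : E →ₗ[ℝ] E) :=
    ⟨hinj, LinearMap.injective_iff_surjective.1 hinj⟩
  refine ⟨((LinearEquiv.ofBijective _ hbij).symm : E →ₗ[ℝ] E), fun z => ?_, fun z => ?_⟩
  · have h := (LinearEquiv.ofBijective _ hbij).apply_symm_apply z
    rw [LinearEquiv.ofBijective_apply, LinearMap.add_apply, LinearMap.id_apply] at h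
    exact h
  · have h := (LinearEquiv.ofBijective _ hbij).symm_apply_apply z
    rw [LinearEquiv.ofBijective_apply, LinearMap.add_apply, LinearMap.id_apply] at h
    exact h

/-- The resolvent map of the linear operator `graph Q`, `(I + Q)⁻¹`, in the sense of
`MonotoneOperator.IsResolventMap`. [cite: Odonoghue2021, §2.2; OdonoghueEtAl2016, §3.2.2] -/
theorem isResolventMap_of_isResolvent (hR : IsResolvent Q R) : IsResolventMap 1 (graph Q) R :=
  fun z => mem_resolvent_iff.2 ⟨Q (R z), mem_graph_iff.2 rfl, by rw [one_smul]; exact hR z⟩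

/-- `ũ^{k+1} = (I + M)⁻¹(w^k − q)`, the first line of (5.2): the resolvent of the affine operator
`F(z) = Mz + q` evaluated at `w`. [cite: Odonoghue2021, §5 (5.2)] -/
def lcpTilde (R : E →ₗ[ℝ] E) (q w : E) : E := R (w - q)

/-- `w = ũ + F(ũ)` for `ũ = (I + M)⁻¹(w − q)` (the representation `w ∈ u + F(u)` of §2.1).
[cite: Odonoghue2021, §2.1 and §5 (5.2)] -/
theorem lcpTilde_spec (hR : IsResolvent M R) (q w : E) :
    lcpTilde R q w + (M (lcpTilde R q w) + q) = w := by
  rw [lcpTilde, ← add_assoc, hR (w - q), sub_add_cancel]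

/-- `w ↦ (I + M)⁻¹(w − q)` is the resolvent map `(I + F)⁻¹` of `F(z) = Mz + q`.
[cite: Odonoghue2021, §2.2 and §5 (5.2)] -/
theorem isResolventMap_lcpTilde (hR : IsResolvent M R) (q : E) :
    IsResolventMap 1 (graph fun z => M z + q) (lcpTilde R q) :=
  fun w => mem_resolvent_iff.2
    ⟨M (lcpTilde R q w) + q, mem_graph_iff.2 rfl, by rw [one_smul]; exact lcpTilde_spec hR q w⟩

/-! ## §5.3, Lemma 5: eliminating the trivial solution -/

/-- **Lemma 5.** Let `𝒯` be positively homogeneous (`𝒯(tv) = t𝒯(v)`, `t > 0`), nonexpansive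
toward any fixed point (`‖𝒯(v) − p‖ ≤ ‖v − p‖` whenever `𝒯 p = p`), and let `w⋆` be a fixed point
with `(w⋆)ᵀw⁰ > 0`. Then `‖w^k‖ ≥ (w⋆)ᵀw⁰/‖w⋆‖ (> 0)` for all `k`, where `w^{k+1} = 𝒯(w^k)`
(proof: `t w⋆` is a fixed point for every `t > 0`, so `‖w^k − tw⋆‖² ≤ ‖w⁰ − tw⋆‖²`, whence
`‖w⋆‖‖w^k‖ ≥ (w⋆)ᵀw⁰ − ‖w⁰‖²/2t`; let `t → ∞`). [cite: Odonoghue2021, §5.3 Lemma 5] -/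
theorem norm_iterate_ge_of_homogeneous {T : E → E}
    (hT : ∀ ⦃t : ℝ⦄, 0 < t → ∀ v, T (t • v) = t • T v) {wstar w₀ : E} (hfix : T wstar = wstar)
    (h0 : 0 < ⟪wstar, w₀⟫) (hne : ∀ ⦃p : E⦄, T p = p → ∀ v, ‖T v - p‖ ≤ ‖v - p‖) (k : ℕ) :
    ⟪wstar, w₀⟫ / ‖wstar‖ ≤ ‖T^[k] w₀‖ := by
  have hws : 0 < ‖wstar‖ := by
    refine norm_pos_iff.2 ?_
    rintro rfl
    simp at h0
  -- `t • w⋆` is a fixed point, so `‖T^k w₀ − t w⋆‖ ≤ ‖w₀ − t w⋆‖`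
  have hk : ∀ ⦃t : ℝ⦄, 0 < t → ‖T^[k] w₀ - t • wstar‖ ≤ ‖w₀ - t • wstar‖ := by
    intro t ht
    have hft : T (t • wstar) = t • wstar := by rw [hT ht, hfix]
    induction k with
    | zero => exact le_rfl
    | succ k ih =>
      rw [Function.iterate_succ_apply']
      exact (hne hft _).trans ih
  -- `‖w⋆‖ ‖T^k w₀‖ ≥ ⟨w⋆, w₀⟩ − ‖w₀‖²/(2t)` for every `t > 0`
  have key : ∀ ⦃t : ℝ⦄, 0 < t → ⟪wstar, w₀⟫ ≤ ‖wstar‖ * ‖T^[k] w₀‖ + ‖w₀‖ ^ 2 / (2 * t) := by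
    intro t ht
    have h2 : ‖T^[k] w₀ - t • wstar‖ ^ 2 ≤ ‖w₀ - t • wstar‖ ^ 2 :=
      pow_le_pow_left₀ (norm_nonneg _) (hk ht) 2
    rw [norm_sub_sq_real, norm_sub_sq_real, real_inner_smul_right, real_inner_smul_right,
      real_inner_comm wstar w₀] at h2
    have h3 : ⟪T^[k] w₀, wstar⟫ ≤ ‖T^[k] w₀‖ * ‖wstar‖ := real_inner_le_norm _ _
    have h3' : t * ⟪T^[k] w₀, wstar⟫ ≤ t * (‖T^[k] w₀‖ * ‖wstar‖) :=
      mul_le_mul_of_nonneg_left h3 ht.le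
    have h4 := sq_nonneg ‖T^[k] w₀‖
    have h5 : (⟪wstar, w₀⟫ - ‖wstar‖ * ‖T^[k] w₀‖) * (2 * t) ≤ ‖w₀‖ ^ 2 := by nlinarith
    have h6 : ⟪wstar, w₀⟫ - ‖wstar‖ * ‖T^[k] w₀‖ ≤ ‖w₀‖ ^ 2 / (2 * t) :=
      (le_div_iff₀ (by positivity)).2 h5
    linarith
  -- let `t → ∞`
  have hmain : ⟪wstar, w₀⟫ ≤ ‖wstar‖ * ‖T^[k] w₀‖ := by
    refine le_of_forall_pos_le_add fun ε hε => ?_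
    have ht : 0 < ‖w₀‖ ^ 2 / (2 * ε) + 1 := by positivity
    have h := key ht
    have hle : ‖w₀‖ ^ 2 / (2 * (‖w₀‖ ^ 2 / (2 * ε) + 1)) ≤ ε := by
      rw [div_le_iff₀ (by positivity)]
      have e : ε * (2 * (‖w₀‖ ^ 2 / (2 * ε) + 1)) = ‖w₀‖ ^ 2 + 2 * ε := by
        field_simp
      rw [e]
      linarith
    linarith
  rw [div_le_iff₀ hws]
  linarith

variable [CompleteSpace E] {K : ProperCone ℝ E} {F : Set (E × E)}

/-! ## §3: MCP(F, 𝒞), the variational inequality, and the inclusion `0 ∈ F(z) + N_𝒞(z)` -/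

/-- `z` solves the **monotone complementarity problem** MCP(F, 𝒞): there is `w ∈ F(z)` with
`𝒞 ∋ z ⊥ w ∈ 𝒞*` (3.1). [cite: Odonoghue2021, §3 (3.1)] -/
def IsMCPSolution (F : Set (E × E)) (K : ProperCone ℝ E) (z : E) : Prop :=
  ∃ w, (z, w) ∈ F ∧ z ∈ K ∧ w ∈ ProperCone.innerDual (K : Set E) ∧ ⟪z, w⟫ = 0

/-- `z ∈ 𝒞` solves the **variational inequality** (3.2): there is `w ∈ F(z)` with `(y − z)ᵀw ≥ 0`
for all `y ∈ 𝒞`. [cite: Odonoghue2021, §3 (3.2)] -/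
def IsVISolution (F : Set (E × E)) (K : ProperCone ℝ E) (z : E) : Prop :=
  z ∈ K ∧ ∃ w, (z, w) ∈ F ∧ ∀ y ∈ K, 0 ≤ ⟪y - z, w⟫

/-- The pointwise equivalence behind (3.1) ⟺ (3.2): for `z ∈ 𝒞`, `w ∈ 𝒞*` and `zᵀw = 0` iff
`(y − z)ᵀw ≥ 0` for all `y ∈ 𝒞` ("clearly `yᵀw ≥ zᵀw = 0` … since `w ∈ 𝒞*`"; conversely "take
`y = z/2` or `y = 3z/2` … so it must be the case that `zᵀw = 0`, then `yᵀw ≥ 0` for all `y ∈ 𝒞`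
implies that `w ∈ 𝒞*`"). [cite: Odonoghue2021, §3 (3.1)–(3.2)] -/
theorem mem_innerDual_and_inner_eq_zero_iff (hz : z ∈ K) :
    (w ∈ ProperCone.innerDual (K : Set E) ∧ ⟪z, w⟫ = 0) ↔ ∀ y ∈ K, 0 ≤ ⟪y - z, w⟫ := by
  constructor
  · rintro ⟨hw, hzw⟩ y hy
    rw [inner_sub_left, hzw, sub_zero]
    exact ProperCone.mem_innerDual.1 hw hy
  · intro h
    have h1 := h ((1 / 2 : ℝ) • z) (K.smul_mem hz (by norm_num))
    have h2 := h ((3 / 2 : ℝ) • z) (K.smul_mem hz (by norm_num))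
    rw [inner_sub_left, real_inner_smul_left] at h1 h2
    have hzw : ⟪z, w⟫ = 0 := by linarith
    refine ⟨ProperCone.mem_innerDual.2 fun y hy => ?_, hzw⟩
    have h3 := h y hy
    rwa [inner_sub_left, hzw, sub_zero] at h3

/-- **(3.1) ⟺ (3.2)**: MCP(F, 𝒞) and the variational inequality have the same solutions.
[cite: Odonoghue2021, §3 (3.1)–(3.2)] -/
theorem isMCPSolution_iff_isVISolution : IsMCPSolution F K z ↔ IsVISolution F K z := by
  constructor
  · rintro ⟨w, hF, hz, hw, hzw⟩
    exact ⟨hz, w, hF, (mem_innerDual_and_inner_eq_zero_iff hz).1 ⟨hw, hzw⟩⟩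
  · rintro ⟨hz, w, hF, h⟩
    obtain ⟨hw, hzw⟩ := (mem_innerDual_and_inner_eq_zero_iff hz).2 h
    exact ⟨w, hF, hz, hw, hzw⟩

/-- The normal cone of the CONE `𝒞`: `x ∈ N_𝒞(z)` iff `z ∈ 𝒞`, `−x ∈ 𝒞*` and `zᵀx = 0` (proof of
Lemma 2: "take any `(z, w) ∈ N_𝒞` and `x ∈ 𝒞`, then … `xᵀw ≤ zᵀw` … since `tx ∈ 𝒞` … it must
be the case that `xᵀw ≤ 0` … it implies that `−w ∈ 𝒞*`", and "`N_𝒞(0) = −𝒞*`").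
[cite: Odonoghue2021, §4.2 proof of Lemma 2] -/
theorem mem_normalCone_iff_mem_innerDual :
    (z, x) ∈ normalCone (K : Set E) ↔
      z ∈ K ∧ -x ∈ ProperCone.innerDual (K : Set E) ∧ ⟪z, x⟫ = 0 := by
  rw [mem_normalCone_iff]
  constructor
  · rintro ⟨hz, h⟩
    have h' : ∀ y ∈ K, 0 ≤ ⟪y - z, -x⟫ := fun y hy => by
      rw [inner_neg_right, real_inner_comm]
      exact neg_nonneg.2 (h y hy)
    obtain ⟨hx, hzx⟩ := (mem_innerDual_and_inner_eq_zero_iff hz).2 h'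
    rw [inner_neg_right, neg_eq_zero] at hzx
    exact ⟨hz, hx, hzx⟩
  · rintro ⟨hz, hx, hzx⟩
    refine ⟨hz, fun c hc => ?_⟩
    have h' := (mem_innerDual_and_inner_eq_zero_iff hz).1
      ⟨hx, by rw [inner_neg_right, hzx, neg_zero]⟩ c hc
    rw [inner_neg_right, real_inner_comm] at h'
    exact neg_nonneg.1 h'

/-- **(3.1) ⟺ (3.3)**: `z` solves MCP(F, 𝒞) iff `0 ∈ F(z) + N_𝒞(z)` ("if `z` satisfies (3.3) then
`z ∈ 𝒞` and there exists `w ∈ F(z)` such that `−w ∈ N_𝒞(z)` … and vice-versa"); here with the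
operator sum written `N_𝒞 + F`, the order consumed by the Douglas–Rachford theorem below.
[cite: Odonoghue2021, §3 (3.3)] -/
theorem isMCPSolution_iff_mem_zer :
    IsMCPSolution F K z ↔ z ∈ zer (opSum (normalCone (K : Set E)) F) := by
  rw [mem_zer_opSum_iff]
  constructor
  · rintro ⟨w, hF, hz, hw, hzw⟩
    refine ⟨w, hF, mem_normalCone_iff_mem_innerDual.2 ⟨hz, ?_, ?_⟩⟩
    · rwa [neg_neg]
    · rw [inner_neg_right, hzw, neg_zero]
  · rintro ⟨w, hF, hN⟩
    obtain ⟨hz, hw, hzw⟩ := mem_normalCone_iff_mem_innerDual.1 hN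
    rw [neg_neg] at hw
    rw [inner_neg_right, neg_eq_zero] at hzw
    exact ⟨w, hF, hz, hw, hzw⟩

omit [InnerProductSpace ℝ E] [CompleteSpace E] in
/-- `A + B = B + A` for operators. [folklore] -/
private theorem opSum_comm (A B : Set (E × E)) : opSum A B = opSum B A := by
  ext ⟨u, v⟩
  constructor <;> rintro ⟨a, b, ha, hb, h⟩ <;> exact ⟨b, a, hb, ha, h.trans (add_comm _ _)⟩

/-- (3.1) ⟺ (3.3) with the sum written `F + N_𝒞` as in (3.3). [cite: Odonoghue2021, §3 (3.3)] -/
theorem isMCPSolution_iff_mem_zer' :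
    IsMCPSolution F K z ↔ z ∈ zer (opSum F (normalCone (K : Set E))) := by
  rw [isMCPSolution_iff_mem_zer, opSum_comm]

/-- "`N_𝒞` is maximal monotone with resolvent `(I + N_𝒞)⁻¹ x = Π_𝒞(x)`, the Euclidean projection
onto `𝒞`": the cone projection is the resolvent map of `N_𝒞` (for any parameter `γ > 0`, `N_𝒞`
being a cone). [cite: Odonoghue2021, §3; LindstromSims2020, §1.3] -/
theorem isResolventMap_coneProj (K : ProperCone ℝ E) {γ : ℝ} (hγ : 0 < γ) :
    IsResolventMap γ (normalCone (K : Set E)) (proj K) := by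
  have e : (proj K : E → E) = ConvexMetricProjection.proj (K : Set E) :=
    funext (ConvexMetricProjection.moreauProj_eq_proj K)
  rw [e]
  exact isResolventMap_proj K.nonempty K.isClosed.isComplete K.convex hγ

/-! ## §3: the monotone linear complementarity problem LCP(M, q, 𝒞) -/

/-- `z` solves **LCP(M, q, 𝒞)**: `𝒞 ∋ z ⊥ (Mz + q) ∈ 𝒞*` (3.5). [cite: Odonoghue2021, §3 (3.5)] -/
def IsLCPSolution (M : E →ₗ[ℝ] E) (q : E) (K : ProperCone ℝ E) (z : E) : Prop :=
  z ∈ K ∧ M z + q ∈ ProperCone.innerDual (K : Set E) ∧ ⟪z, M z + q⟫ = 0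

/-- LCP(M, q, 𝒞) is MCP(F, 𝒞) for the single-valued affine `F(z) = Mz + q`.
[cite: Odonoghue2021, §3 (3.4)–(3.5)] -/
theorem isLCPSolution_iff_isMCPSolution :
    IsLCPSolution M q K z ↔ IsMCPSolution (graph fun z => M z + q) K z := by
  constructor
  · rintro ⟨hz, hw, h0⟩
    exact ⟨M z + q, mem_graph_iff.2 rfl, hz, hw, h0⟩
  · rintro ⟨w, hw, hz, hw', h0⟩
    rw [mem_graph_iff] at hw
    subst hw
    exact ⟨hz, hw', h0⟩

/-! ## §4.2: feasibility, the certificate (4.4), Lemma 2, weak alternatives -/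

/-- "LCP(M, q, 𝒞) is feasible if and only if there exists a point `(z, w) ∈ N_𝒞 ∩ 𝒜`",
`𝒜 = {(z, w) | w = −(Mz + q)}`, pointwise: `z` solves LCP(M, q, 𝒞) iff `(z, −(Mz + q)) ∈ N_𝒞`.
[cite: Odonoghue2021, §4.2] -/
theorem isLCPSolution_iff_mem_normalCone :
    IsLCPSolution M q K z ↔ (z, -(M z + q)) ∈ normalCone (K : Set E) := by
  rw [mem_normalCone_iff_mem_innerDual, neg_neg, inner_neg_right, neg_eq_zero]
  exact Iff.rfl

/-- A **certificate of (strong) infeasibility** of LCP(M, q, 𝒞), condition (4.4): `λᵀq < 0` and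
`sup_{(z,w) ∈ N_𝒞} λᵀ(Mz + w) ≤ 0`. [cite: Odonoghue2021, §4.2 (4.4)] -/
def IsInfeasCert (M : E →ₗ[ℝ] E) (q : E) (K : ProperCone ℝ E) (lam : E) : Prop :=
  ⟪lam, q⟫ < 0 ∧ ∀ z w, (z, w) ∈ normalCone (K : Set E) → ⟪lam, M z + w⟫ ≤ 0

/-- **Lemma 2** (for monotone `M`): `λ` satisfies (4.4) if and only if `λ` solves LCP(M, 0, 𝒞),
`𝒞 ∋ λ ⊥ Mλ ∈ 𝒞*` (4.5), with `λᵀq < 0` (proof as in the source: `z = 0` and `N_𝒞(0) = −𝒞*`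
give `λ ∈ 𝒞`; `0 ∈ N_𝒞(z)` for `z ∈ 𝒞` gives `λᵀMz ≤ 0`, so `λᵀMλ = 0` and `Mλ = −Mᵀλ ∈ 𝒞*`
by (3.6); conversely `−w ∈ 𝒞*` and (3.6)). [cite: Odonoghue2021, §4.2 Lemma 2] -/
theorem isInfeasCert_iff (hM : ∀ z, 0 ≤ ⟪z, M z⟫) :
    IsInfeasCert M q K lam ↔ IsLCPSolution M 0 K lam ∧ ⟪lam, q⟫ < 0 := by
  constructor
  · rintro ⟨hq, h⟩
    -- `λ ∈ 𝒞 = 𝒞**`: with `z = 0`, `⟨λ, −v⟩ ≤ 0` for every `v ∈ 𝒞*`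
    have hlam : lam ∈ K := by
      have h2 : lam ∈ ProperCone.innerDual (ProperCone.innerDual (K : Set E) : Set E) := by
        refine ProperCone.mem_innerDual.2 fun v hv => ?_
        have h' := h 0 (-v) (mem_normalCone_iff_mem_innerDual.2
          ⟨K.zero_mem, by rw [neg_neg]; exact hv, by rw [inner_zero_left]⟩)
        rw [map_zero, zero_add, inner_neg_right, real_inner_comm] at h'
        linarith
      rwa [ProperCone.innerDual_innerDual] at h2
    -- `−Mᵀλ ∈ 𝒞*`: for `z ∈ 𝒞`, `0 ∈ N_𝒞(z)` gives `λᵀMz ≤ 0`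
    have hMz : ∀ y ∈ K, ⟪lam, M y⟫ ≤ 0 := fun y hy => by
      have h' := h y 0 (mem_normalCone_iff_mem_innerDual.2
        ⟨hy, by rw [neg_zero]; exact (ProperCone.innerDual _).zero_mem, by rw [inner_zero_right]⟩)
      rwa [add_zero] at h'
    have h0 : ⟪lam, M lam⟫ = 0 := le_antisymm (hMz lam hlam) (hM lam)
    -- `Mλ = −Mᵀλ ∈ 𝒞*` by (3.6)
    have hMlam : M lam ∈ ProperCone.innerDual (K : Set E) := by
      refine ProperCone.mem_innerDual.2 fun y hy => ?_
      have e := inner_add_inner_eq_zero hM h0 y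
      linarith [hMz y hy]
    exact ⟨⟨hlam, by rwa [add_zero], by rw [add_zero, h0]⟩, hq⟩
  · rintro ⟨⟨hlam, hMlam, h0⟩, hq⟩
    rw [add_zero] at hMlam h0
    refine ⟨hq, fun y w hyw => ?_⟩
    obtain ⟨hy, hw, -⟩ := mem_normalCone_iff_mem_innerDual.1 hyw
    have h1 : ⟪lam, w⟫ ≤ 0 := by
      have h' := ProperCone.mem_innerDual.1 hw hlam
      rw [inner_neg_right] at h'
      linarith
    have h2 : ⟪lam, M y⟫ ≤ 0 := by
      have e := inner_add_inner_eq_zero hM h0 y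
      have h' := ProperCone.mem_innerDual.1 hMlam hy
      linarith
    rw [inner_add_right]
    linarith

/-- **Weak alternatives**: "the existence of such a `λ` precludes the existence of
`(z, w) ∈ N_𝒞 ∩ 𝒜` … at most one of (4.4) and (3.5) has a solution".
[cite: Odonoghue2021, §4.2] -/
theorem not_isLCPSolution_of_isInfeasCert (hcert : IsInfeasCert M q K lam) (z : E) :
    ¬ IsLCPSolution M q K z := by
  intro hz
  have h := hcert.2 z (-(M z + q)) (isLCPSolution_iff_mem_normalCone.1 hz)
  have e : M z + -(M z + q) = -q := by abel
  rw [e, inner_neg_right] at h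
  linarith [hcert.1]

/-! ## §5, (5.2): Douglas–Rachford splitting applied to LCP(M, q, 𝒞) -/

/-- `u^{k+1} = Π_𝒞(2ũ^{k+1} − w^k)`, the second line of (5.2). [cite: Odonoghue2021, §5 (5.2)] -/
def lcpU (K : ProperCone ℝ E) (R : E →ₗ[ℝ] E) (q w : E) : E :=
  proj K ((2 : ℝ) • lcpTilde R q w - w)

/-- `w^{k+1} = w^k + u^{k+1} − ũ^{k+1}`, the third line of (5.2): one step `w^k ↦ w^{k+1}`.
[cite: Odonoghue2021, §5 (5.2)] -/
def lcpStep (K : ProperCone ℝ E) (R : E →ₗ[ℝ] E) (q w : E) : E :=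
  w + lcpU K R q w - lcpTilde R q w

/-- The iterates `w^k` of (5.2) from `w⁰`. [cite: Odonoghue2021, §5 (5.2)] -/
def lcpIter (K : ProperCone ℝ E) (R : E →ₗ[ℝ] E) (q w₀ : E) (k : ℕ) : E :=
  (lcpStep K R q)^[k] w₀

/-- `v^{k+1} = u^{k+1} + w^k − 2ũ^{k+1}`. [cite: Odonoghue2021, §5.4] -/
def lcpV (K : ProperCone ℝ E) (R : E →ₗ[ℝ] E) (q w : E) : E :=
  lcpU K R q w + w - (2 : ℝ) • lcpTilde R q w

/-- `w⁰` is the initial point. [cite: Odonoghue2021, §5 (5.2)] -/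
@[simp] theorem lcpIter_zero (w₀ : E) : lcpIter K R q w₀ 0 = w₀ := rfl

/-- `w^{k+1}` is one step from `w^k`. [cite: Odonoghue2021, §5 (5.2)] -/
theorem lcpIter_succ (w₀ : E) (k : ℕ) :
    lcpIter K R q w₀ (k + 1) = lcpStep K R q (lcpIter K R q w₀ k) :=
  Function.iterate_succ_apply' _ _ _

/-- (5.2) "is DR splitting applied to LCP(M, q, 𝒞) directly": the step is the Douglas–Rachford map
`G = J_A(2J_B − I) + (I − J_B)` of [EB92, §4] for `A = N_𝒞` (`J_A = Π_𝒞`) and `B = F`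
(`J_B = (I + M)⁻¹(· − q)`).
[cite: Odonoghue2021, §5 (5.1)–(5.2); EcksteinBertsekas1992, §4 p. 303] -/
theorem lcpStep_eq_drStep : lcpStep K R q = drStep (proj K) (lcpTilde R q) := by
  funext w
  simp only [lcpStep, lcpU, drStep]
  abel

/-- Hence `w^k` are the Douglas–Rachford iterates. [cite: Odonoghue2021, §5 (5.1)–(5.2)] -/
theorem lcpIter_eq_drIter : lcpIter K R q = drIter (proj K) (lcpTilde R q) := by
  funext w₀ k
  rw [lcpIter, drIter, lcpStep_eq_drStep]

/-- `u^{k+1} = w^{k+1} − w^k + ũ^{k+1}` (the third line of (5.2) solved for `u`).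
[cite: Odonoghue2021, §5 (5.2)] -/
theorem lcpU_eq (w : E) : lcpU K R q w = lcpStep K R q w - w + lcpTilde R q w := by
  rw [lcpStep]; abel

/-- The step (5.2) is nonexpansive ("if the operator `𝒯` corresponds to one step of DR splitting
then it is globally non-expansive").
[cite: Odonoghue2021, §5.3; EcksteinBertsekas1992, §4 Cor 4.1] -/
theorem norm_lcpStep_sub_le (hM : ∀ z, 0 ≤ ⟪z, M z⟫) (hR : IsResolvent M R) (q w w' : E) :
    ‖lcpStep K R q w - lcpStep K R q w'‖ ≤ ‖w - w'‖ := by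
  rw [lcpStep_eq_drStep]
  exact norm_drStep_sub_le (isResolventMap_coneProj K one_pos) (isResolventMap_lcpTilde hR q)
    (isMonotone_normalCone _) ((isMonotone_graph_affine_iff q).2 hM) one_pos w' w

/-- A fixed point `w` of (5.2) yields the solution `ũ = (I + M)⁻¹(w − q)` of LCP(M, q, 𝒞) ("will
converge to a fixed point from which we can derive a solution"). [cite: Odonoghue2021, §5 and §2.1;
EcksteinBertsekas1992, §4 Thm 5] -/
theorem isLCPSolution_of_lcpStep_eq_self (hM : ∀ z, 0 ≤ ⟪z, M z⟫) (hR : IsResolvent M R)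
    (h : lcpStep K R q w = w) : IsLCPSolution M q K (lcpTilde R q w) := by
  rw [lcpStep_eq_drStep] at h
  exact isLCPSolution_iff_isMCPSolution.2 (isMCPSolution_iff_mem_zer.2
    (apply_mem_zer_opSum_of_drStep_eq_self (isResolventMap_coneProj K one_pos)
      (isResolventMap_lcpTilde hR q) (isMonotone_normalCone _)
      ((isMonotone_graph_affine_iff q).2 hM) one_pos h))

/-- Conversely every solution `z` of LCP(M, q, 𝒞) is `ũ` at some fixed point of (5.2) (so (5.2) has
a fixed point iff the LCP is feasible: "otherwise it has no fixed point").
[cite: Odonoghue2021, §5 (5.2); EcksteinBertsekas1992, §4 Thm 5] -/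
theorem exists_lcpStep_eq_self (hM : ∀ z, 0 ≤ ⟪z, M z⟫) (hR : IsResolvent M R)
    (hz : IsLCPSolution M q K z) : ∃ w, lcpStep K R q w = w ∧ lcpTilde R q w = z := by
  rw [lcpStep_eq_drStep]
  exact exists_drStep_eq_self_of_mem_zer (isResolventMap_coneProj K one_pos)
    (isResolventMap_lcpTilde hR q) (isMonotone_normalCone _)
    ((isMonotone_graph_affine_iff q).2 hM) one_pos
    (isMCPSolution_iff_mem_zer.1 (isLCPSolution_iff_isMCPSolution.1 hz))

/-- **Convergence of (5.2)** ("if a solution to LCP(M, q, 𝒞) exists then this procedure will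
converge"; §2.1: "`w^k → w⋆`"), in finite dimension: the iterates converge to a fixed point.
[cite: Odonoghue2021, §5 (5.2) and §2.1; EcksteinBertsekas1992, §4 Cor 6.1] -/
theorem exists_tendsto_lcpIter [FiniteDimensional ℝ E] (hM : ∀ z, 0 ≤ ⟪z, M z⟫)
    (hR : IsResolvent M R) (hsol : ∃ z, IsLCPSolution M q K z) (w₀ : E) :
    ∃ wstar, lcpStep K R q wstar = wstar ∧ Tendsto (lcpIter K R q w₀) atTop (𝓝 wstar) := by
  have hzer : (zer (opSum (normalCone (K : Set E)) (graph fun z => M z + q))).Nonempty := by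
    obtain ⟨z, hz⟩ := hsol
    exact ⟨z, isMCPSolution_iff_mem_zer.1 (isLCPSolution_iff_isMCPSolution.1 hz)⟩
  obtain ⟨wstar, hfix, -, hlim, -⟩ := exists_tendsto_drIter (isResolventMap_coneProj K one_pos)
    (isResolventMap_lcpTilde hR q) (isMonotone_normalCone _)
    ((isMonotone_graph_affine_iff q).2 hM) one_pos hzer w₀
  refine ⟨wstar, ?_, ?_⟩
  · rw [lcpStep_eq_drStep]; exact hfix
  · rw [lcpIter_eq_drIter]; exact hlim

/-- §2.1 "`ũ^k`" : along a convergent run `w^k → w⋆`, `ũ^{k+1} = (I + M)⁻¹(w^k − q) → ũ⋆ :=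
(I + M)⁻¹(w⋆ − q)` (continuity of the resolvent). [cite: Odonoghue2021, §2.1 and §5.4] -/
theorem tendsto_lcpTilde (hM : ∀ z, 0 ≤ ⟪z, M z⟫) (hR : IsResolvent M R) {w₀ wstar : E}
    (hlim : Tendsto (lcpIter K R q w₀) atTop (𝓝 wstar)) :
    Tendsto (fun k => lcpTilde R q (lcpIter K R q w₀ k)) atTop (𝓝 (lcpTilde R q wstar)) :=
  (((isResolventMap_lcpTilde hR q).continuous ((isMonotone_graph_affine_iff q).2 hM)
    one_pos).tendsto wstar).comp hlim

/-- §2.1 "`u^k → u⋆`": `u^{k+1} = w^{k+1} − w^k + ũ^{k+1} → ũ⋆`, the solution carried by the fixed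
point `w⋆`. [cite: Odonoghue2021, §2.1 and §5.4] -/
theorem tendsto_lcpU (hM : ∀ z, 0 ≤ ⟪z, M z⟫) (hR : IsResolvent M R) {w₀ wstar : E}
    (hlim : Tendsto (lcpIter K R q w₀) atTop (𝓝 wstar)) :
    Tendsto (fun k => lcpU K R q (lcpIter K R q w₀ k)) atTop (𝓝 (lcpTilde R q wstar)) := by
  have hsucc : Tendsto (fun k => lcpIter K R q w₀ (k + 1)) atTop (𝓝 wstar) :=
    hlim.comp (tendsto_add_atTop_nat 1)
  have e : (fun k => lcpU K R q (lcpIter K R q w₀ k)) = fun k =>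
      lcpIter K R q w₀ (k + 1) - lcpIter K R q w₀ k + lcpTilde R q (lcpIter K R q w₀ k) := by
    funext k
    rw [lcpIter_succ, lcpU_eq]
  rw [e]
  have h := (hsucc.sub hlim).add (tendsto_lcpTilde hM hR hlim)
  rwa [sub_self, zero_add] at h

/-- §2.1 "`‖u^k − ũ^k‖ → 0`". [cite: Odonoghue2021, §2.1 and §5.4] -/
theorem tendsto_lcpU_sub_lcpTilde (hM : ∀ z, 0 ≤ ⟪z, M z⟫) (hR : IsResolvent M R)
    {w₀ wstar : E} (hlim : Tendsto (lcpIter K R q w₀) atTop (𝓝 wstar)) :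
    Tendsto (fun k => lcpU K R q (lcpIter K R q w₀ k) - lcpTilde R q (lcpIter K R q w₀ k))
      atTop (𝓝 0) := by
  have h := (tendsto_lcpU hM hR hlim).sub (tendsto_lcpTilde hM hR hlim)
  rwa [sub_self] at h

/-! ## §5.4: the dual iterates `v^k` -/

/-- "combined with the Moreau decomposition": `v^{k+1} = Π_{𝒞*}(−2ũ^{k+1} + w^k)`.
[cite: Odonoghue2021, §5.4] -/
theorem lcpV_eq_proj_innerDual (w : E) :
    lcpV K R q w = proj (ProperCone.innerDual (K : Set E)) (w - (2 : ℝ) • lcpTilde R q w) := by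
  have e : lcpV K R q w = -(proj (polar K) ((2 : ℝ) • lcpTilde R q w - w)) := by
    rw [proj_polar_eq, lcpV, lcpU]; abel
  rw [e, proj_polar_eq_neg_proj_innerDual_neg, neg_neg, neg_sub]

/-- (5.6), first part: `u^k ∈ 𝒞`. [cite: Odonoghue2021, §5.4 (5.6)] -/
theorem lcpU_mem (w : E) : lcpU K R q w ∈ K := proj_mem

/-- (5.6), second part: `v^k ∈ 𝒞*`. [cite: Odonoghue2021, §5.4 (5.6)] -/
theorem lcpV_mem_innerDual (w : E) : lcpV K R q w ∈ ProperCone.innerDual (K : Set E) := by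
  rw [lcpV_eq_proj_innerDual]; exact proj_mem

/-- (5.6), third part: `u^k ⊥ v^k` ("`u^{k+1}` and `v^{k+1}` correspond to the orthogonal Moreau
decomposition of `2ũ^{k+1} − w^k`"). [cite: Odonoghue2021, §5.4 (5.6)] -/
theorem inner_lcpU_lcpV (w : E) : ⟪lcpU K R q w, lcpV K R q w⟫ = 0 := by
  have e : lcpV K R q w = -(proj (polar K) ((2 : ℝ) • lcpTilde R q w - w)) := by
    rw [proj_polar_eq, lcpV, lcpU]; abel
  rw [e, inner_neg_right, lcpU, inner_proj_proj_polar, neg_zero]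

/-- "This sequence converges to `𝒬(u⋆)` since `v^{k+1} = u^{k+1} + w^k − 2ũ^{k+1} → w⋆ − u⋆`": here
`v^{k+1} → w⋆ − ũ⋆ = Mũ⋆ + q = F(ũ⋆)`. [cite: Odonoghue2021, §5.4] -/
theorem tendsto_lcpV (hM : ∀ z, 0 ≤ ⟪z, M z⟫) (hR : IsResolvent M R) {w₀ wstar : E}
    (hlim : Tendsto (lcpIter K R q w₀) atTop (𝓝 wstar)) :
    Tendsto (fun k => lcpV K R q (lcpIter K R q w₀ k)) atTop
      (𝓝 (M (lcpTilde R q wstar) + q)) := by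
  have h := ((tendsto_lcpU hM hR hlim).add hlim).sub ((tendsto_lcpTilde hM hR hlim).const_smul
    (2 : ℝ))
  have e : lcpTilde R q wstar + wstar - (2 : ℝ) • lcpTilde R q wstar =
      M (lcpTilde R q wstar) + q := by
    have hw := lcpTilde_spec hR q wstar
    calc lcpTilde R q wstar + wstar - (2 : ℝ) • lcpTilde R q wstar
        = wstar - lcpTilde R q wstar := by rw [two_smul]; abel
      _ = M (lcpTilde R q wstar) + q := by
        nth_rewrite 1 [← hw]
        abel
  rw [e] at h
  exact h

/-! ## §5.3: Lemma 5 for the homogeneous problem LCP(M, 0, 𝒞) and for SCS -/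

/-- For `q = 0` the step (5.2) is positively homogeneous ("DR splitting is positively homogeneous,
since both [operators] are positively homogeneous"). [cite: Odonoghue2021, §5.3] -/
theorem lcpStep_zero_smul {t : ℝ} (ht : 0 ≤ t) (w : E) :
    lcpStep K R 0 (t • w) = t • lcpStep K R 0 w := by
  have h1 : lcpTilde R 0 (t • w) = t • lcpTilde R 0 w := by
    simp only [lcpTilde, sub_zero, map_smul]
  have h2 : lcpU K R 0 (t • w) = t • lcpU K R 0 w := by
    simp only [lcpU, h1]
    rw [smul_comm (2 : ℝ) t, ← smul_sub, proj_smul ht]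
  simp only [lcpStep, h1, h2, smul_add, smul_sub]

/-- Lemma 5 applied to (5.2) for the homogeneous problem LCP(M, 0, 𝒞): if `w⋆` is a fixed point with
`(w⋆)ᵀw⁰ > 0` then `‖w^k‖ ≥ (w⋆)ᵀw⁰/‖w⋆‖ > 0`. [cite: Odonoghue2021, §5.3 Lemma 5] -/
theorem norm_lcpIter_zero_ge (hM : ∀ z, 0 ≤ ⟪z, M z⟫) (hR : IsResolvent M R) {wstar w₀ : E}
    (hfix : lcpStep K R 0 wstar = wstar) (h0 : 0 < ⟪wstar, w₀⟫) (k : ℕ) :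
    ⟪wstar, w₀⟫ / ‖wstar‖ ≤ ‖lcpIter K R 0 w₀ k‖ :=
  norm_iterate_ge_of_homogeneous (fun _ ht v => lcpStep_zero_smul ht.le v) hfix h0
    (fun p hp v => by
      have h := norm_lcpStep_sub_le (K := K) hM hR 0 v p
      rwa [hp] at h) k

/-- Lemma 5 applied to SCS [OCPB16] ("here we generalize a result from [OCPB16]"): for a solution
`p = (u⋆, v⋆)` of the embedding (a fixed point of `φ`) with `⟨p, z⁰⟩ > 0`,
`‖(u^k, v^k)‖ ≥ ⟨p, z⁰⟩/‖p‖ > 0` — the constant of [OCPB16, §3.4]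
(`SplittingConicSolver.norm_scsIter_ge`) without the factor `1/2`.
[cite: Odonoghue2021, §5.3 Lemma 5; OdonoghueEtAl2016, §3.4] -/
theorem norm_scsIter_ge' (hQ : IsSkew Q) (hR : IsResolvent Q R) {p : WithLp 2 (E × E)}
    (hp : scsStep K R p = p) {z₀ : WithLp 2 (E × E)} (h0 : 0 < ⟪p, z₀⟫) (k : ℕ) :
    ⟪p, z₀⟫ / ‖p‖ ≤ ‖scsIter K R z₀ k‖ :=
  norm_iterate_ge_of_homogeneous (fun _ ht v => scsStep_smul ht.le v) hp h0
    (fun p' hp' v => by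
      have h := norm_scsStep_sub_le (K := K) hQ hR v p'
      rwa [hp'] at h) k

/-! ## SCS is a Douglas–Rachford iteration ([OCPB16, §3.2.3, Appendix]; [ODo21, §5.2]) -/

/-- The Moreau pair `P(x) = (Π_𝒞(x), −Π_{−𝒞*}(x)) = (Π_𝒞 x, Π_𝒞 x − x)` of the Appendix of
[OCPB16]. [cite: OdonoghueEtAl2016, Appendix (Nonexpansivity)] -/
def moreauPair (K : ProperCone ℝ E) (x : E) : WithLp 2 (E × E) :=
  WithLp.toLp 2 (proj K x, proj K x - x)

/-- `φ = P ∘ L`: "the second and third steps [are] a combined Moreau decomposition" of the point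
`L(u, v) = ũ − v`. [cite: OdonoghueEtAl2016, §3.2.3; Appendix (Nonexpansivity)] -/
theorem scsStep_eq_moreauPair_linStep (p : WithLp 2 (E × E)) :
    scsStep K R p = moreauPair K (linStep R p.fst p.snd) := rfl

/-- `L ∘ P` is the Douglas–Rachford step `J_A(2J_B − I) + (I − J_B)` with `J_A = (I + Q)⁻¹`,
`J_B = Π_𝒞`: `L(Π_𝒞 x, Π_𝒞 x − x) = (I + Q)⁻¹(2Π_𝒞 x − x) + (x − Π_𝒞 x)` — the "change of
variables required to go from ADMM to DR splitting".
[cite: Odonoghue2021, §5.2; OdonoghueEtAl2016, §3.2.3] -/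
theorem linStep_moreauPair (x : E) :
    linStep R (proj K x) (proj K x - x) = drStep R (proj K) x := by
  simp only [linStep, drStep]
  rw [two_smul, ← add_sub_assoc]
  abel

/-- Hence `φ(P x) = P(G x)` for the Douglas–Rachford step `G`.
[cite: Odonoghue2021, §5.2; OdonoghueEtAl2016, §3.2.3] -/
theorem scsStep_moreauPair (x : E) :
    scsStep K R (moreauPair K x) = moreauPair K (drStep R (proj K) x) := by
  rw [scsStep_eq_moreauPair_linStep]
  simp only [moreauPair, WithLp.toLp_fst, WithLp.toLp_snd, linStep_moreauPair]

/-- … and `φ^k(P x) = P(G^k x)`: an SCS run started at a Moreau pair is the Moreau-pair image of a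
Douglas–Rachford run. [cite: Odonoghue2021, §5.2; OdonoghueEtAl2016, §3.2.3] -/
theorem scsIter_moreauPair (x : E) (k : ℕ) :
    scsIter K R (moreauPair K x) k = moreauPair K (drIter R (proj K) x k) := by
  induction k with
  | zero => rfl
  | succ k ih => rw [scsIter_succ, drIter_succ, ih, scsStep_moreauPair]

/-- For an arbitrary initial `(u⁰, v⁰)`: `(u^{k+1}, v^{k+1}) = P(G^k(L(u⁰, v⁰)))`.
[cite: Odonoghue2021, §5.2; OdonoghueEtAl2016, §3.2.3] -/
theorem scsIter_succ_eq_moreauPair_drIter (p : WithLp 2 (E × E)) (k : ℕ) :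
    scsIter K R p (k + 1) = moreauPair K (drIter R (proj K) (linStep R p.fst p.snd) k) := by
  have h : scsIter K R p (k + 1) = scsIter K R (scsStep K R p) k :=
    Function.iterate_succ_apply _ _ _
  rw [h, scsStep_eq_moreauPair_linStep, scsIter_moreauPair]

/-- `P` is continuous (both Moreau parts are `1`-Lipschitz). [cite: OdonoghueEtAl2016, Appendix
(Nonexpansivity)] -/
theorem continuous_moreauPair (K : ProperCone ℝ E) : Continuous (moreauPair K) := by
  have hP : Continuous (proj K : E → E) :=
    (isResolventMap_coneProj K one_pos).continuous (isMonotone_normalCone _) one_pos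
  exact (WithLp.prod_continuous_toLp 2 E E).comp (hP.prodMk (hP.sub continuous_id))

/-- **Convergence of SCS** (the Douglas–Rachford / ADMM convergence theory that [OCPB16, §3.4]
invokes): for skew `Q`, `R = (I + Q)⁻¹` and any cone, in finite dimension, the SCS iterates
`(u^k, v^k)` converge to a fixed point of `φ`, i.e. (`scsStep_eq_self_iff`) to a solution
`u ∈ 𝒞, v ∈ 𝒞*, Qu = v` of the embedding (`0` is always a solution, so no feasibility hypothesis
is needed). [cite: OdonoghueEtAl2016, §3.4; Odonoghue2021, §5.2 and §5.4;
EcksteinBertsekas1992, §4 Cor 6.1] -/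
theorem exists_tendsto_scsIter [FiniteDimensional ℝ E] (hQ : IsSkew Q) (hR : IsResolvent Q R)
    (p : WithLp 2 (E × E)) :
    ∃ pstar : WithLp 2 (E × E), scsStep K R pstar = pstar ∧
      Tendsto (scsIter K R p) atTop (𝓝 pstar) := by
  have hzer : (zer (opSum (graph Q) (normalCone (K : Set E)))).Nonempty :=
    ⟨0, mem_zer_opSum_iff.2 ⟨0, mem_normalCone_iff.2 ⟨K.zero_mem, fun c _ => by
      rw [inner_zero_left]⟩, mem_graph_iff.2 (by rw [neg_zero, map_zero])⟩⟩
  obtain ⟨x, hx, -, hlim, -⟩ := exists_tendsto_drIter (isResolventMap_of_isResolvent hR)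
    (isResolventMap_coneProj K one_pos) (isMonotone_graph_of_isSkew hQ) (isMonotone_normalCone _)
    one_pos hzer (linStep R p.fst p.snd)
  refine ⟨moreauPair K x, by rw [scsStep_moreauPair, hx], ?_⟩
  have h1 : Tendsto (fun k => scsIter K R p (k + 1)) atTop (𝓝 (moreauPair K x)) := by
    have e : (fun k => scsIter K R p (k + 1)) =
        fun k => moreauPair K (drIter R (proj K) (linStep R p.fst p.snd) k) :=
      funext (scsIter_succ_eq_moreauPair_drIter p)
    rw [e]
    exact ((continuous_moreauPair K).tendsto x).comp hlim
  exact (tendsto_add_atTop_iff_nat 1).1 h1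

/-- **[OCPB16, (17)]**: "only one more condition must hold for `(u^k, v^k)` to be optimal:
`Qu^k = v^k`. This equality constraint holds asymptotically, that is … `Qu^k − v^k → 0`"
(finite dimension, exact projections, no over-relaxation). [cite: OdonoghueEtAl2016, §3.4 (17)] -/
theorem tendsto_skew_fst_sub_snd [FiniteDimensional ℝ E] (hQ : IsSkew Q) (hR : IsResolvent Q R)
    (p : WithLp 2 (E × E)) :
    Tendsto (fun k => Q (scsIter K R p k).fst - (scsIter K R p k).snd) atTop (𝓝 0) := by
  obtain ⟨pstar, hfix, hlim⟩ := exists_tendsto_scsIter (K := K) hQ hR p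
  obtain ⟨-, -, hQuv⟩ := (scsStep_eq_self_iff hQ hR pstar).1 hfix
  have hc : Continuous fun z : WithLp 2 (E × E) => Q z.fst - z.snd :=
    (Q.continuous_of_finiteDimensional.comp (WithLp.continuous_fst 2 E E)).sub
      (WithLp.continuous_snd 2 E E)
  have h := (hc.tendsto pstar).comp hlim
  rw [hQuv, sub_self] at h
  exact h

/-- "Eliminating convergence to zero", for the limit: if some solution `p̂` of the embedding has
`⟨p̂, (u⁰, v⁰)⟩ > 0`, the limit `p⋆` of the SCS iterates has `‖p⋆‖ ≥ ⟨p̂, (u⁰, v⁰)⟩/‖p̂‖`.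
[cite: Odonoghue2021, §5.3 Lemma 5; OdonoghueEtAl2016, §3.4] -/
theorem div_le_norm_of_tendsto_scsIter (hQ : IsSkew Q) (hR : IsResolvent Q R)
    {phat : WithLp 2 (E × E)} (hphat : scsStep K R phat = phat) {p pstar : WithLp 2 (E × E)}
    (h0 : 0 < ⟪phat, p⟫) (hlim : Tendsto (scsIter K R p) atTop (𝓝 pstar)) :
    ⟪phat, p⟫ / ‖phat‖ ≤ ‖pstar‖ :=
  ge_of_tendsto' hlim.norm fun k => norm_scsIter_ge' hQ hR hphat h0 k

/-- … in particular the limit is a NONZERO solution of the embedding ("we can guarantee that the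
algorithm will not converge to zero if a nonzero solution exists, by proper selection of the
initial point"). [cite: OdonoghueEtAl2016, §3.4; Odonoghue2021, §5.3 Lemma 5] -/
theorem ne_zero_of_tendsto_scsIter (hQ : IsSkew Q) (hR : IsResolvent Q R)
    {phat : WithLp 2 (E × E)} (hphat : scsStep K R phat = phat) {p pstar : WithLp 2 (E × E)}
    (h0 : 0 < ⟪phat, p⟫) (hlim : Tendsto (scsIter K R p) atTop (𝓝 pstar)) : pstar ≠ 0 := by
  have hphat0 : 0 < ‖phat‖ := by
    refine norm_pos_iff.2 ?_
    rintro rfl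
    simp at h0
  have h := div_le_norm_of_tendsto_scsIter hQ hR hphat h0 hlim
  intro hp
  rw [hp, norm_zero] at h
  exact absurd h (not_le.2 (div_pos h0 hphat0))

end Literature.Analysis.Convex.DouglasRachfordLCP

end
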